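import Mathlib

/-!
# val-idea-34 (g7) — EXCHANGE-SET CEILING for the sparse-tower record engine

Scratch for crux `stmt-ValiantsHypothesis-5906` (`TwoProducts`).  VP ≠ VNP is NOT proved; nothing here is a tree write or a claim.
This is an OBSTRUCTION-SIDE lemma about a METHOD (idea-37 g4 `TowerRecords_val_idea_37_g4.lean` §10), not about the crux.

CONTEXT.  `towerRecordCountG` (idea-37 g4, answer to crit-8 VERDICT #19 (ii)): for tower pencils with level set `E` and ANY
exchange set `Λ` with `2m·|Λ + E| < (2m+1)·|Λ|`, the coefficient-side record count is `≤ 64 (n²|J| + 3)(m+1)2^{3m}` for every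
`J ⊇ Λ − Λ`; three levels `{0,1,H}` admit `|J| ≤ (8m+3)²` for every `H` (`threeLevelRecordLaw_holds`), and the file names as the
residual «towers with MANY levels of LARGE height» — F10's binary digit towers `{2^j : j < h}`.

THIS FILE (all PROVED, kernel-checked, `Mathlib` only):
* `near_invariant`     : an exchange set is NEARLY INVARIANT under every level difference: `2m·|(Λ + (e'−e)) \ Λ| < |Λ|` for `e, e' ∈ E`;
* `exc_add_le`/`exc_sum_le` : exception counts are subadditive under composition of shifts;
* `mem_sub_of_exc_lt`  : a shift with fewer than `|Λ|` exceptions is a difference of two elements of `Λ`;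
* `exchangeSet_ceiling_int` / `exchangeSet_ceiling` (ℕ form, idea-37's hypotheses verbatim in shape):
  if `E ⊇ {2^j : j < h}` then EVERY exchange set has  `|J| ≥ #{F ⊆ [0, h−1) : |F| ≤ 2m} = Σ_{i ≤ 2m} C(h−1, i)`,
  in particular `|J| ≥ C(h−1, 2m)` (`choose_le_card_of_exchangeSet`).

CONSEQUENCE (method ceiling, informal arithmetic): on a binary tower with `h` levels the cell factor of the exchange-set engine is
`≥ C(h−1, 2m) ≥ ((h−1)/2m)^{2m}`; for `h − 1 = 2m·R` this is `≥ (R)^{2m}·(e/1)^{…} > 2^{am}` as soon as `R > 2^{a/2}`, and then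
`> 2^{am}(t+2)^b` for `m > b·log₂(h+2)` (here `t ≥ h`): so NO choice of exchange set makes `towerRecordCountG` a D-free law
`∃ a b, ∀ m t …` on binary towers — the interval `Λ = [0, m·2^h]` (|J| = 2m·2^h + 1) is optimal up to the factor `4m` when `h ≤ 2m+1`.
What would lift the ceiling: relations ADAPTED to the weight `ξ` (Cramer relations in the `ξ`-optimal valuated basis) instead of one
uniform exchange set per cell — see the seat's NOTES (lever «parametric valuated bases», not filed: its D-free count is unproved).
-/

open Finset
open scoped Pointwise

namespace ValIdea34g7

/-! ## 1. Exception counts of integer shifts -/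

/-- Exception count of the shift `s` on `L`: the points of `L + s` that leave `L`. -/
def exc (L : Finset ℤ) (s : ℤ) : ℕ := ((L.image (· + s)) \ L).card

theorem card_image_add (L : Finset ℤ) (s : ℤ) : (L.image (· + s)).card = L.card :=
  card_image_of_injective _ (add_left_injective s)

theorem image_add_image_add (L : Finset ℤ) (s s' : ℤ) :
    (L.image (· + s)).image (· + s') = L.image (· + (s + s')) := by
  rw [image_image]
  congr 1
  funext x
  simp [Function.comp, add_assoc]

theorem exc_zero (L : Finset ℤ) : exc L 0 = 0 := by
  unfold exc
  simp

/-- Subadditivity: `exc (s + s') ≤ exc s + exc s'`. -/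
theorem exc_add_le (L : Finset ℤ) (s s' : ℤ) : exc L (s + s') ≤ exc L s + exc L s' := by
  unfold exc
  have key : (L.image (· + (s + s'))) \ L ⊆
      ((L.image (· + (s + s'))) \ (L.image (· + s'))) ∪ ((L.image (· + s')) \ L) := by
    intro x hx
    rw [mem_sdiff] at hx
    rw [mem_union, mem_sdiff, mem_sdiff]
    by_cases h : x ∈ L.image (· + s')
    · exact Or.inr ⟨h, hx.2⟩
    · exact Or.inl ⟨hx.1, h⟩
  have h1 : (L.image (· + (s + s'))) \ (L.image (· + s')) = ((L.image (· + s)) \ L).image (· + s') := by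
    rw [image_sdiff _ _ (add_left_injective s'), image_add_image_add]
  calc ((L.image (· + (s + s'))) \ L).card
      ≤ (((L.image (· + (s + s'))) \ (L.image (· + s'))) ∪ ((L.image (· + s')) \ L)).card := card_le_card key
    _ ≤ ((L.image (· + (s + s'))) \ (L.image (· + s'))).card + ((L.image (· + s')) \ L).card := card_union_le _ _
    _ = ((L.image (· + s)) \ L).card + ((L.image (· + s')) \ L).card := by
        rw [h1, card_image_of_injective _ (add_left_injective s')]

/-- Subadditivity over a finite sum of shifts. -/
theorem exc_sum_le (L : Finset ℤ) {ι : Type*} [DecidableEq ι] (F : Finset ι) (g : ι → ℤ) :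
    exc L (∑ j ∈ F, g j) ≤ ∑ j ∈ F, exc L (g j) := by
  induction F using Finset.induction_on with
  | empty => simp [exc_zero]
  | insert a F ha ih =>
      rw [sum_insert ha, sum_insert ha]
      exact (exc_add_le L _ _).trans (Nat.add_le_add_left ih _)

/-- A shift with fewer than `|L|` exceptions is a difference of two elements of `L`. -/
theorem mem_sub_of_exc_lt (L : Finset ℤ) (s : ℤ) (h : exc L s < L.card) : ∃ u ∈ L, ∃ v ∈ L, u - v = s := by
  by_contra hne
  push Not at hne
  have hdisj : Disjoint (L.image (· + s)) L := by
    rw [disjoint_left]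
    intro x hx hxL
    obtain ⟨v, hv, rfl⟩ := mem_image.mp hx
    exact hne (v + s) hxL v hv (by ring)
  have : exc L s = L.card := by
    unfold exc
    rw [sdiff_eq_self_of_disjoint hdisj, card_image_add]
  omega

/-! ## 2. Near-invariance of an exchange set under level differences -/

/-- **Near-invariance.** If `2m·|L + E| < (2m+1)·|L|` then for all levels `e, e' ∈ E` the shift `e' − e` moves fewer than
`|L|/2m` points of `L` outside `L`. -/
theorem near_invariant (m : ℕ) (L E : Finset ℤ) (hΛ : 2 * m * (L + E).card < (2 * m + 1) * L.card)
    {e e' : ℤ} (he : e ∈ E) (he' : e' ∈ E) : 2 * m * exc L (e' - e) < L.card := by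
  have hA : L.image (· + e) ⊆ L + E := by
    intro x hx
    obtain ⟨u, hu, rfl⟩ := mem_image.mp hx
    exact add_mem_add hu he
  have hB : L.image (· + e') ⊆ L + E := by
    intro x hx
    obtain ⟨u, hu, rfl⟩ := mem_image.mp hx
    exact add_mem_add hu he'
  have hsd : (L.image (· + e) ∪ L.image (· + e')) \ L.image (· + e) = L.image (· + e') \ L.image (· + e) := by
    ext x
    simp only [mem_sdiff, mem_union]
    tauto
  have h3 : (L.image (· + e') \ L.image (· + e)).card = exc L (e' - e) := by
    unfold exc
    rw [show L.image (· + e') = (L.image (· + (e' - e))).image (· + e) by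
          rw [image_add_image_add, sub_add_cancel],
        ← image_sdiff _ _ (add_left_injective e), card_image_of_injective _ (add_left_injective e)]
  have h2 : (L.image (· + e) ∪ L.image (· + e')).card = L.card + exc L (e' - e) := by
    have := card_sdiff_add_card_eq_card (subset_union_left (s₁ := L.image (· + e)) (s₂ := L.image (· + e')))
    rw [hsd, h3, card_image_add] at this
    omega
  have h1 : (L.image (· + e) ∪ L.image (· + e')).card ≤ (L + E).card := card_le_card (union_subset hA hB)
  rw [h2] at h1
  have h4 : 2 * m * (L.card + exc L (e' - e)) ≤ 2 * m * (L + E).card := Nat.mul_le_mul_left _ h1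
  nlinarith

/-! ## 3. The ceiling: every exchange set of a binary tower contains all short binary sums in `Λ − Λ` -/

/-- Binary sum of a finite set of exponents, as an integer. -/
def binSum (F : Finset ℕ) : ℤ := ∑ j ∈ F, (2 : ℤ) ^ j

theorem binSum_eq_cast (F : Finset ℕ) : binSum F = ((∑ j ∈ F, 2 ^ j : ℕ) : ℤ) := by
  unfold binSum
  push_cast
  rfl

theorem binSum_injective : Function.Injective binSum := by
  intro F G h
  rw [binSum_eq_cast, binSum_eq_cast] at h
  have h' : (∑ j ∈ F, 2 ^ j : ℕ) = ∑ j ∈ G, 2 ^ j := by exact_mod_cast h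
  have : Finset.equivBitIndices.symm F = Finset.equivBitIndices.symm G := by
    rw [Finset.equivBitIndices_symm_apply, Finset.equivBitIndices_symm_apply]
    exact h'
  exact Finset.equivBitIndices.symm.injective this

/-- **EXCHANGE-SET CEILING (integer form).**  If the level set contains the binary tower `{2^j : j < h}` and `Λ` is an exchange set
(`2m·|Λ + E| < (2m+1)·|Λ|`), then every binary sum of at most `2m` distinct levels below `2^{h−1}` lies in `Λ − Λ ⊆ J`; hence
`|J| ≥ #{F ⊆ [0,h−1) : |F| ≤ 2m}`. -/
theorem exchangeSet_ceiling_int (m h : ℕ) (L E : Finset ℤ) (hE : ∀ j < h, ((2 : ℤ) ^ j) ∈ E)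
    (hΛ : 2 * m * (L + E).card < (2 * m + 1) * L.card) (J : Finset ℤ) (hJ : ∀ u ∈ L, ∀ v ∈ L, u - v ∈ J) :
    (((range (h - 1)).powerset).filter (fun F => F.card ≤ 2 * m)).card ≤ J.card := by
  have hLpos : 0 < L.card := by
    by_contra h0
    push Not at h0
    have : L.card = 0 := by omega
    rw [this] at hΛ
    simp at hΛ
  -- every admissible binary sum is a difference of two elements of `L`
  have hmem : ∀ F ∈ ((range (h - 1)).powerset).filter (fun F => F.card ≤ 2 * m), binSum F ∈ J := by
    intro F hF
    rw [mem_filter, mem_powerset] at hF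
    obtain ⟨hFr, hFc⟩ := hF
    -- near-invariance under each `2^j`, `j < h-1` (as `2^{j+1} − 2^j`)
    have hj : ∀ j ∈ F, 2 * m * exc L ((2 : ℤ) ^ j) < L.card := by
      intro j hjF
      have hjlt : j < h - 1 := mem_range.mp (hFr hjF)
      have h1 : ((2 : ℤ) ^ j) ∈ E := hE j (by omega)
      have h2 : ((2 : ℤ) ^ (j + 1)) ∈ E := hE (j + 1) (by omega)
      have := near_invariant m L E hΛ h1 h2
      rwa [show (2 : ℤ) ^ (j + 1) - 2 ^ j = 2 ^ j by ring] at this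
    have hexc : exc L (binSum F) < L.card := by
      rcases Nat.eq_zero_or_pos m with hm | hm
      · -- m = 0: F = ∅, the sum is 0
        have hF0 : F = ∅ := by
          rw [hm] at hFc
          exact card_eq_zero.mp (by omega)
        subst hF0
        simp [binSum, exc_zero, hLpos]
      · have hsum : exc L (binSum F) ≤ ∑ j ∈ F, exc L ((2 : ℤ) ^ j) := exc_sum_le L F _
        have hbd : ∀ j ∈ F, exc L ((2 : ℤ) ^ j) ≤ L.card - 1 := by
          intro j hjF
          have := hj j hjF
          -- 2m * exc < L.card with m ≥ 1 ⇒ exc ≤ (L.card - 1)  (indeed 2m*exc ≤ L.card - 1)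
          have : exc L ((2 : ℤ) ^ j) * (2 * m) < L.card := by rwa [mul_comm] at this
          have h2m : 1 ≤ 2 * m := by omega
          have : exc L ((2 : ℤ) ^ j) ≤ exc L ((2 : ℤ) ^ j) * (2 * m) := Nat.le_mul_of_pos_right _ (by omega)
          omega
        have hsum2 : ∑ j ∈ F, exc L ((2 : ℤ) ^ j) ≤ ∑ _j ∈ F, (L.card - 1) := sum_le_sum hbd
        rw [sum_const, smul_eq_mul] at hsum2
        -- 2m * exc(binSum) ≤ Σ 2m * exc(2^j) < ... ; simpler: exc ≤ F.card * (L.card-1)?? need exc < L.card.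
        -- use: 2m * exc(binSum F) ≤ Σ_j 2m*exc(2^j) ≤ Σ_j (L.card - 1) = F.card (L.card-1) ≤ 2m (L.card-1)
        have hbd' : ∀ j ∈ F, 2 * m * exc L ((2 : ℤ) ^ j) ≤ L.card - 1 := by
          intro j hjF
          have := hj j hjF
          omega
        have hsum3 : ∑ j ∈ F, 2 * m * exc L ((2 : ℤ) ^ j) ≤ ∑ _j ∈ F, (L.card - 1) := sum_le_sum hbd'
        rw [sum_const, smul_eq_mul, ← mul_sum] at hsum3
        have h4 : 2 * m * exc L (binSum F) ≤ F.card * (L.card - 1) :=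
          (Nat.mul_le_mul_left _ hsum).trans hsum3
        have h5 : F.card * (L.card - 1) ≤ 2 * m * (L.card - 1) := Nat.mul_le_mul_right _ hFc
        have h6 : 2 * m * exc L (binSum F) ≤ 2 * m * (L.card - 1) := h4.trans h5
        have h7 : exc L (binSum F) ≤ L.card - 1 := Nat.le_of_mul_le_mul_left h6 (by omega)
        omega
    obtain ⟨u, hu, v, hv, huv⟩ := mem_sub_of_exc_lt L _ hexc
    rw [← huv]
    exact hJ u hu v hv
  exact card_le_card_of_injOn binSum hmem (binSum_injective.injOn)

/-- In particular `|J| ≥ C(h−1, 2m)`. -/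
theorem choose_le_card_of_exchangeSet_int (m h : ℕ) (L E : Finset ℤ) (hE : ∀ j < h, ((2 : ℤ) ^ j) ∈ E)
    (hΛ : 2 * m * (L + E).card < (2 * m + 1) * L.card) (J : Finset ℤ) (hJ : ∀ u ∈ L, ∀ v ∈ L, u - v ∈ J) :
    (h - 1).choose (2 * m) ≤ J.card := by
  refine le_trans ?_ (exchangeSet_ceiling_int m h L E hE hΛ J hJ)
  rw [← card_range (h - 1), ← card_powersetCard]
  refine card_le_card fun F hF => ?_
  rw [mem_powersetCard] at hF
  rw [mem_filter, mem_powerset, card_range]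
  exact ⟨hF.1, hF.2.le⟩

/-! ## 4. Natural-number form (the hypotheses of idea-37 g4's `card_cellLettersG_le` / `towerRecordCountG`, verbatim in shape) -/

/-- **EXCHANGE-SET CEILING.**  `E Λ : Finset ℕ`, `2m·|Λ + E| < (2m+1)·|Λ|`, `J ⊇ Λ − Λ` (as integers), `E ⊇ {2^j : j < h}`:
then `|J| ≥ #{F ⊆ [0, h−1) : |F| ≤ 2m}`. -/
theorem exchangeSet_ceiling (m h : ℕ) (E Λ : Finset ℕ) (hE : ∀ j < h, 2 ^ j ∈ E)
    (hΛ : 2 * m * (Λ + E).card < (2 * m + 1) * Λ.card) (J : Finset ℤ)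
    (hJ : ∀ u ∈ Λ, ∀ v ∈ Λ, ((u : ℤ) - v) ∈ J) :
    (((range (h - 1)).powerset).filter (fun F => F.card ≤ 2 * m)).card ≤ J.card := by
  set L : Finset ℤ := Λ.image (Nat.castAddMonoidHom ℤ) with hL
  set E' : Finset ℤ := E.image (Nat.castAddMonoidHom ℤ) with hE'
  have hinj : Function.Injective (Nat.castAddMonoidHom ℤ) := fun a b hab => by simpa using hab
  have hLE : L + E' = (Λ + E).image (Nat.castAddMonoidHom ℤ) := by
    rw [hL, hE', ← image_add]
  have hcard1 : (L + E').card = (Λ + E).card := by rw [hLE, card_image_of_injective _ hinj]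
  have hcard2 : L.card = Λ.card := by rw [hL, card_image_of_injective _ hinj]
  have hΛ' : 2 * m * (L + E').card < (2 * m + 1) * L.card := by rwa [hcard1, hcard2]
  have hE'' : ∀ j < h, ((2 : ℤ) ^ j) ∈ E' := by
    intro j hj
    rw [hE', mem_image]
    exact ⟨2 ^ j, hE j hj, by simp⟩
  have hJ' : ∀ u ∈ L, ∀ v ∈ L, u - v ∈ J := by
    intro u hu v hv
    rw [hL, mem_image] at hu hv
    obtain ⟨u₀, hu₀, rfl⟩ := hu
    obtain ⟨v₀, hv₀, rfl⟩ := hv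
    simpa using hJ u₀ hu₀ v₀ hv₀
  exact exchangeSet_ceiling_int m h L E' hE'' hΛ' J hJ'

/-- In particular `|J| ≥ C(h−1, 2m)` for every exchange set of a binary tower with `h` levels. -/
theorem choose_le_card_of_exchangeSet (m h : ℕ) (E Λ : Finset ℕ) (hE : ∀ j < h, 2 ^ j ∈ E)
    (hΛ : 2 * m * (Λ + E).card < (2 * m + 1) * Λ.card) (J : Finset ℤ)
    (hJ : ∀ u ∈ Λ, ∀ v ∈ Λ, ((u : ℤ) - v) ∈ J) :
    (h - 1).choose (2 * m) ≤ J.card := by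
  refine le_trans ?_ (exchangeSet_ceiling m h E Λ hE hΛ J hJ)
  rw [← card_range (h - 1), ← card_powersetCard]
  refine card_le_card fun F hF => ?_
  rw [mem_powersetCard] at hF
  rw [mem_filter, mem_powerset, card_range]
  exact ⟨hF.1, hF.2.le⟩

/-! ## 5. Sanity: the ceiling bites (`C(h−1,2m)` vs the currency `2^{am}(t+2)^b`, two numeric instances) -/

/-- With `a = b = 2`, `m = 8`, `h − 1 = 96` levels (`t = h = 97`): `C(96,16) > 2^{16}·99²`. -/
example : 2 ^ (2 * 8) * (97 + 2) ^ 2 < Nat.choose 96 16 := by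
  rw [Nat.choose_eq_descFactorial_div_factorial]
  decide +kernel

/-- idea-37 g4's three-level constants `(a,b) = (23,2)` are beaten as well: `m = 8`, `h − 1 = 2^17` levels:
`C(2^17, 16) > 2^{184}·(2^17 + 3)²`. -/
example : 2 ^ (23 * 8) * (2 ^ 17 + 1 + 2) ^ 2 < Nat.choose (2 ^ 17) 16 := by
  rw [Nat.choose_eq_descFactorial_div_factorial]
  decide +kernel

end ValIdea34g7

#print axioms ValIdea34g7.exchangeSet_ceiling
#print axioms ValIdea34g7.choose_le_card_of_exchangeSet
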